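import Summits.AtomisticToContinuum.FouriersLaw.Theorems.BondHeatUncertaintyBoundedResponseBathHeatKickProfileB
import HarnessLib

/-!
# BondHeatUncertainty / BoundedResponse — «KickProfile» §4: the RESPONSE RUNGS beneath 11071 — crossing defects, late response floors, the comparison
principle, kick-convexity; doors into `LateKernelFloor` / `LateVarChannelFloor` / `LateCommonPastFloor` and the assembly to `BoundedResponse` given (S)
(decomp-a2c lens-1, g110, NODE 110 «KickProfile / EnergyResponse»; part 3 of 4 — overview in part 1 `…KickProfileA`)

LADDER (every arrow PROVED here, `a > 0`; lens-1 grading = ORDER OF THE SHAPE CONSTRAINT on the 1-D response curve):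
  `LateKinResponseConvex a` (ER∪) ⟹ `LateKinResponseMonotone a` (ER↑, via evenness) ⟹ `LateKinResponseFloor a p α` (ERᶠ, every grade, `A = 0`)
  ⟹ `LateKernelFloor a p α` ⟹ [α > 2, p ≤ α − 1; tree NODE 109] `LateNegMass a` ⟹ `LateTailFloor a 1 1` ⟹ (with (S)) `BoundedResponse` = 11071;
  `LateVarResponseMonotone a` (TR↑) ⟹ `LateVarResponseFloor a p α` (TRᶠ) ⟹ `LateVarChannelFloor a p α` (critic's 1a);  `LateSqFcastResponseFloor` (MRᶠ) ⟹ `LateCommonPastFloor`.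
Beneath them (part 1): affine + SOS certificates (NODE 108 `integral_kinObs_mul_affineSumSq_nonneg`) are the degree-≤-2 sub-cone of the single-crossing cone.
Every `def … : Prop` here is a ROUTE STATEMENT of this cell (hung, tagged in its docstring), not a literature fact.  No `sorry`, no new axioms.
-/

noncomputable section

open MeasureTheory ProbabilityTheory Filter Topology Set Function
open scoped NNReal ENNReal
open Literature.MathematicalPhysics.KineticTheory.HeatConduction
open Literature.MathematicalPhysics.KineticTheory OscillatorChain
open Literature.Probability.Process
open Summit.AtomisticToContinuum.FouriersLaw.Theorems.IncoherentChannel.Negative.KernelMoments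
  (harmonic_kernel_momentum harmonic_kernel_momentum_sq)
open Summit.AtomisticToContinuum.FouriersLaw.Theorems.IncoherentChannel.Negative.HarmonicFlow
  (harmonic_chainFlow_zero_noise_linear integral_gibbsMeasure_comp_neg integral_gibbsMeasure_eq_zero_of_odd)
open Summit.AtomisticToContinuum.FouriersLaw.Theorems.IncoherentChannel.Negative.GibbsStein
  (integrable_gibbsMeasure_of_growth pow_le_one_add_sq_sq)

namespace Summit.AtomisticToContinuum.FouriersLaw.Theorems.BoundedResponse.HeatSpreading

/-! ## §4 The RESPONSE RUNGS: crossing defects of the three curves, the late floors they supply, the ladder to 11071 -/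

/-- **Energy-response defect `𝔇^G_N(t) := 𝔇_T(Ḡ_{N,t})`** — the `|θ_T|`-weighted `L¹(ν_T)` distance of the energy response curve from the
single-crossing cone (`0` iff — up to `ν_T`-null sets — a harder kick that starts above/below the thermal level never flips side later).  `K_N(t) ≥ −𝔇^G_N(t)`.
[formal bookkeeping] -/
def kinResponseDefect (ω₂ lam β γ T : ℝ) (N : ℕ) (t : ℝ) : ℝ :=
  thermalCrossDefect T (kinKickProfile ω₂ lam β γ T N t)

/-- **Temperature-response defect `𝔇^V_N(t) := 𝔇_T(V̄_{N,t})`**; `VC_N(t) ≥ −𝔇^V_N(t)`. [formal bookkeeping] -/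
def varResponseDefect (ω₂ lam β γ T : ℝ) (N : ℕ) (t : ℝ) : ℝ :=
  thermalCrossDefect T (varKickProfile ω₂ lam β γ T N t)

/-- **Coherent-response defect `𝔇^M_N(t) := 𝔇_T(M̄_{N,t})`**; `CP_N(t) ≥ −𝔇^M_N(t)`. [formal bookkeeping] -/
def sqFcastResponseDefect (ω₂ lam β γ T : ℝ) (N : ℕ) (t : ℝ) : ℝ :=
  thermalCrossDefect T (sqFcastKickProfile ω₂ lam β γ T N t)

section DefectFloors

variable {ω₂ lam β γ : ℝ} (hω : 0 < ω₂) (hl : 0 < lam) (hβ : 0 < β) (hγ : 0 < γ) {T : ℝ} (hT : 0 < T)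
include hω hl hβ hγ hT

/-- ★★ **POINTWISE STEIN FLOORS** (every `N`, every real `t`): `K_N(t) ≥ −𝔇^G_N(t)`, `VC_N(t) ≥ −𝔇^V_N(t)`, `CP_N(t) ≥ −𝔇^M_N(t)`. [this cell] -/
theorem channel_ge_neg_responseDefect (N : ℕ) (t : ℝ) :
    -kinResponseDefect ω₂ lam β γ T N t ≤ bathKinCorr ω₂ lam β γ T N t ∧
      -varResponseDefect ω₂ lam β γ T N t ≤ bathVarChannel ω₂ lam β γ T N t ∧
      -sqFcastResponseDefect ω₂ lam β γ T N t ≤ bathCommonPast ω₂ lam β γ T N t := by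
  rcases Nat.eq_zero_or_pos N with h0 | hN
  · subst h0
    have h1 := thermalCrossDefect_nonneg T (kinKickProfile ω₂ lam β γ T 0 t)
    have h2 := thermalCrossDefect_nonneg T (varKickProfile ω₂ lam β γ T 0 t)
    have h3 := thermalCrossDefect_nonneg T (sqFcastKickProfile ω₂ lam β γ T 0 t)
    simp only [kinResponseDefect, varResponseDefect, sqFcastResponseDefect, bathKinCorr, bathVarChannel, bathCommonPast,
      lt_self_iff_false, dif_neg, not_false_eq_true]
    exact ⟨by linarith, by linarith, by linarith⟩
  obtain ⟨n, rfl⟩ : ∃ n, N = n + 1 := ⟨N - 1, by omega⟩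
  obtain ⟨hG, eG⟩ := bathKinCorr_eq_integral_kinKickProfile hω hl hβ hγ hT n t
  obtain ⟨hV, eV⟩ := bathVarChannel_eq_integral_varKickProfile hω hl hβ hγ hT n t
  obtain ⟨hM, eM⟩ := bathCommonPast_eq_integral_sqFcastKickProfile hω hl hβ hγ hT n t
  refine ⟨?_, ?_, ?_⟩
  · rw [eG]; exact integral_sqSub_mul_ge_neg_thermalCrossDefect hT.le hG
  · rw [eV]; exact integral_sqSub_mul_ge_neg_thermalCrossDefect hT.le hV
  · rw [eM]; exact integral_sqSub_mul_ge_neg_thermalCrossDefect hT.le hM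

end DefectFloors

/-- **(ERᶠ_{a,p,α}) `LateKinResponseFloor a p α`** — past the light cone the energy response curve is single-crossing up to an echo-tolerant defect:
`∃ A N₀ ∀ N ≥ N₀ ∀ t ≥ aN, 𝔇^G_N(t) ≤ A·N^p·t^{−α}`.  SUFFICIENT for `LateKernelFloor a p α` (`lateKernelFloor_of_lateKinResponseFloor`); at `(α−1, α)`, `α > 2`,
with (S) ⟹ 11071.  Phonon: `Ḡ` is an exact convex parabola (§5), defect `0`.  Why it might fail: an amplitude-dependent ECHO — a hard kick returns to the
bath site LATER (or earlier) than a soft one (anharmonic group velocity), so at fixed `t ≈ 2N/v(k)` the curve `k ↦ Ḡ_{N,t}(k)` is non-monotone with TWO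
crossings and defect `≍` echo amplitude `≍ 1/N` — tolerated by the family only if `≤ A N^{α−1} t^{−α} ≍ A/N` at `t ≍ N`, i.e. marginally.
Tag: UNDECIDED · phonon-TRUE (defect 0) · SUFFICIENT-only · INSTRUMENTABLE (KICK-110 = kit j347822: `ĝ_t(k)` on 13 Gauss–Hermite kicks, late window
`t ≥ N/4`) · IDEA-NEEDED (a comparison principle for the averaged energy response). [route statement · this cell; NOT a literature fact] -/
def LateKinResponseFloor (a p α : ℝ) : Prop :=
  ∀ ω₂ lam β γ : ℝ, 0 < ω₂ → 0 < lam → 0 < β → 0 < γ → ∀ T : ℝ, 0 < T →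
    ∃ A : ℝ, ∃ N₀ : ℕ, ∀ N : ℕ, N₀ ≤ N → ∀ t : ℝ, a * N ≤ t →
      kinResponseDefect ω₂ lam β γ T N t ≤ A * (N : ℝ) ^ p * t ^ (-α)

/-- **(TRᶠ_{a,p,α}) `LateVarResponseFloor a p α`** — the TEMPERATURE response curve `V̄_{N,t}` is single-crossing up to `A·N^p·t^{−α}` past the light cone.
SUFFICIENT for `LateVarChannelFloor a p α` — the critic's 1a in Stein form.  Phonon: `V̄_{N,t}` is CONSTANT in `k` (§5; the conditional variance of a linear
SDE does not see the initial state), defect `0` with room.  Diffusive heuristic: `V̄_{N,t}(k) − V̄_{N,t}(0) ≈ c·(k² − T)·t^{−1/2…−3/2} ≥ 0`-ordered (the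
injected energy thermalises locally and raises the later boundary temperature monotonically) — TRUE-leaning.  Why it might fail: FOCUSING — in a hard
anharmonic pinning well a harder kick DEphases faster and can forecast a momentarily COLDER boundary (`∂_e V̄ < 0`) at intermediate times; harmless unless
a slow boundary mode carries it past `t ≥ aN`.  Tag: UNDECIDED · phonon-TRUE · SUFFICIENT-only · INSTRUMENTABLE (FORK/KICK-110: `V̄` = kick profile of
the two-replica variance) · IDEA-NEEDED. [route statement · this cell; NOT a literature fact] -/
def LateVarResponseFloor (a p α : ℝ) : Prop :=
  ∀ ω₂ lam β γ : ℝ, 0 < ω₂ → 0 < lam → 0 < β → 0 < γ → ∀ T : ℝ, 0 < T →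
    ∃ A : ℝ, ∃ N₀ : ℕ, ∀ N : ℕ, N₀ ≤ N → ∀ t : ℝ, a * N ≤ t →
      varResponseDefect ω₂ lam β γ T N t ≤ A * (N : ℝ) ^ p * t ^ (-α)

/-- **(MRᶠ_{a,p,α}) `LateSqFcastResponseFloor a p α`** — the COHERENT response curve `M̄_{N,t}` is single-crossing up to `A·N^p·t^{−α}` past the light cone;
SUFFICIENT for `LateCommonPastFloor a p α`.  Phonon: `M̄` is an exact convex parabola `a_t² k² + b_t` (§5).  Why it might fail: the ECHO again (it lives in
`m_t`): amplitude-dependent return times make `k ↦ M̄_{N,2N/v}(k)` bimodal.  Tag: UNDECIDED · phonon-TRUE · SUFFICIENT-only · INSTRUMENTABLE (FORK/KICK-110).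
[route statement · this cell; NOT a literature fact] -/
def LateSqFcastResponseFloor (a p α : ℝ) : Prop :=
  ∀ ω₂ lam β γ : ℝ, 0 < ω₂ → 0 < lam → 0 < β → 0 < γ → ∀ T : ℝ, 0 < T →
    ∃ A : ℝ, ∃ N₀ : ℕ, ∀ N : ℕ, N₀ ≤ N → ∀ t : ℝ, a * N ≤ t →
      sqFcastResponseDefect ω₂ lam β γ T N t ≤ A * (N : ℝ) ^ p * t ^ (-α)

/-- **(ER↑_a) `LateKinResponseMonotone a`** — the ATOMISTIC COMPARISON PRINCIPLE past the light cone: for `N ≥ N₀`, `t ≥ aN`, the energy response curve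
`Ḡ_{N,t}` agrees `ν_T`-a.e. with a function NONDECREASING IN THE INJECTED ENERGY `k²/2` («more energy put into the bath particle now never means less
boundary kinetic energy later, after averaging the thermal rest and the noise»).  ⟹ (ERᶠ_{a,p,α}) for EVERY `(p, α)` with `A = 0`, hence `K_N ≥ 0` on the late
window.  Phonon-TRUE (even convex parabola).  Why it might fail: as (ERᶠ) — echo timing; and it is a SIGN statement (NODE 107 H5 warns against sharp sign
claims), kept only because the instrument measures exactly this curve.  Tag: UNDECIDED · phonon-TRUE · INSTRUMENTABLE (KICK-110: is `k ↦ ĝ_t(k)` monotone in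
`|k|` for `t ≥ N/4`?) · strongest rung. [route statement · this cell; NOT a literature fact] -/
def LateKinResponseMonotone (a : ℝ) : Prop :=
  ∀ ω₂ lam β γ : ℝ, 0 < ω₂ → 0 < lam → 0 < β → 0 < γ → ∀ T : ℝ, 0 < T →
    ∃ N₀ : ℕ, ∀ N : ℕ, N₀ ≤ N → ∀ t : ℝ, a * N ≤ t →
      ∃ R : ℝ → ℝ, (∀ k₁ k₂ : ℝ, k₁ ^ 2 ≤ k₂ ^ 2 → R k₁ ≤ R k₂) ∧
        kinKickProfile ω₂ lam β γ T N t =ᵐ[gaussianReal 0 T.toNNReal] R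

/-- **(TR↑_a) `LateVarResponseMonotone a`** — LOCAL-EQUILIBRIUM MONOTONICITY past the light cone: the temperature response curve `V̄_{N,t}` is (`ν_T`-a.e.)
nondecreasing in the injected energy («a harder kick never forecasts a COLDER boundary later»).  ⟹ (TRᶠ_{a,p,α}) for every `(p, α)`, hence `VC_N ≥ 0` late.
Phonon-TRUE with equality (`V̄` constant).  Why it might fail: focusing (see (TRᶠ)).  Tag: UNDECIDED · phonon-TRUE · INSTRUMENTABLE (FORK/KICK-110) · the
cleanest typed form of the critic's «LocalEquilibriumChannel». [route statement · this cell; NOT a literature fact] -/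
def LateVarResponseMonotone (a : ℝ) : Prop :=
  ∀ ω₂ lam β γ : ℝ, 0 < ω₂ → 0 < lam → 0 < β → 0 < γ → ∀ T : ℝ, 0 < T →
    ∃ N₀ : ℕ, ∀ N : ℕ, N₀ ≤ N → ∀ t : ℝ, a * N ≤ t →
      ∃ R : ℝ → ℝ, (∀ k₁ k₂ : ℝ, k₁ ^ 2 ≤ k₂ ^ 2 → R k₁ ≤ R k₂) ∧
        varKickProfile ω₂ lam β γ T N t =ᵐ[gaussianReal 0 T.toNNReal] R

/-- **(ER∪_a) `LateKinResponseConvex a`** — KICK-CONVEXITY past the light cone: `Ḡ_{N,t}` agrees `ν_T`-a.e. with a CONVEX function of the kick `k`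
(the regularity-free `E_{μ_T}[∂²_{p₀} G_t] ≥ 0` pointwise-in-`k` after averaging the rest).  With evenness (§3) ⟹ (ER↑_a).  Phonon-TRUE EXACTLY (parabola).
Why it might fail: saturation — in a hard well the energy response to a very hard kick grows sublinearly in `k²` at fixed late `t` (slower transport of
high-amplitude excitations: discrete-breather-like trapping near the boundary), making `Ḡ` concave at large `|k|`; the Gaussian weight makes this cheap
but the statement is pointwise.  Tag: UNDECIDED · phonon-TRUE · INSTRUMENTABLE (KICK-110 parabola residual) · top rung. [route statement · this cell; NOT a
literature fact] -/
def LateKinResponseConvex (a : ℝ) : Prop :=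
  ∀ ω₂ lam β γ : ℝ, 0 < ω₂ → 0 < lam → 0 < β → 0 < γ → ∀ T : ℝ, 0 < T →
    ∃ N₀ : ℕ, ∀ N : ℕ, N₀ ≤ N → ∀ t : ℝ, a * N ≤ t →
      ∃ R : ℝ → ℝ, ConvexOn ℝ Set.univ R ∧ kinKickProfile ω₂ lam β γ T N t =ᵐ[gaussianReal 0 T.toNNReal] R

/-! ### The doors -/

/-- ★ **(ERᶠ_{a,p,α}) ⟹ LateKernelFloor a p α.** [this cell] -/
theorem lateKernelFloor_of_lateKinResponseFloor {a p α : ℝ} (h : LateKinResponseFloor a p α) : LateKernelFloor a p α := by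
  intro ω₂ lam β γ hω hl hβ hγ T hT
  obtain ⟨A, N₀, hA⟩ := h ω₂ lam β γ hω hl hβ hγ T hT
  refine ⟨A, N₀, fun N hN t ht => ?_⟩
  have h1 := (channel_ge_neg_responseDefect hω hl hβ hγ hT N t).1
  have h2 := hA N hN t ht
  unfold kinResponseDefect at h2
  unfold kinResponseDefect at h1
  linarith

/-- ★ **(TRᶠ_{a,p,α}) ⟹ LateVarChannelFloor a p α** (the critic's 1a, Stein form ⟹ channel form). [this cell] -/
theorem lateVarChannelFloor_of_lateVarResponseFloor {a p α : ℝ} (h : LateVarResponseFloor a p α) : LateVarChannelFloor a p α := by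
  intro ω₂ lam β γ hω hl hβ hγ T hT
  obtain ⟨A, N₀, hA⟩ := h ω₂ lam β γ hω hl hβ hγ T hT
  refine ⟨A, N₀, fun N hN t ht => ?_⟩
  have h1 := (channel_ge_neg_responseDefect hω hl hβ hγ hT N t).2.1
  have h2 := hA N hN t ht
  unfold varResponseDefect at h1 h2
  linarith

/-- ★ **(MRᶠ_{a,p,α}) ⟹ LateCommonPastFloor a p α.** [this cell] -/
theorem lateCommonPastFloor_of_lateSqFcastResponseFloor {a p α : ℝ} (h : LateSqFcastResponseFloor a p α) :
    LateCommonPastFloor a p α := by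
  intro ω₂ lam β γ hω hl hβ hγ T hT
  obtain ⟨A, N₀, hA⟩ := h ω₂ lam β γ hω hl hβ hγ T hT
  refine ⟨A, N₀, fun N hN t ht => ?_⟩
  have h1 := (channel_ge_neg_responseDefect hω hl hβ hγ hT N t).2.2
  have h2 := hA N hN t ht
  unfold sqFcastResponseDefect at h1 h2
  linarith

/-- An a.e.-monotone-in-energy curve with `θ_T`-integrable profile has ZERO crossing defect. [this cell's lemma] -/
theorem thermalCrossDefect_eq_zero_of_ae_monotoneSq {T : ℝ} (hT : 0 ≤ T) {g R : ℝ → ℝ}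
    (hg : Integrable (fun k : ℝ => (k ^ 2 - T) * g k) (gaussianReal 0 T.toNNReal))
    (hmono : ∀ k₁ k₂ : ℝ, k₁ ^ 2 ≤ k₂ ^ 2 → R k₁ ≤ R k₂) (hae : g =ᵐ[gaussianReal 0 T.toNNReal] R) :
    thermalCrossDefect T g = 0 := by
  rw [thermalCrossDefect_congr_ae hae]
  have hR : Integrable (fun k : ℝ => (k ^ 2 - T) * R k) (gaussianReal 0 T.toNNReal) :=
    hg.congr (by filter_upwards [hae] with k hk; rw [hk])
  exact thermalCrossDefect_eq_zero_of_affineCross (affineCross_of_monotoneSq hT hmono) hR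

/-- ★ **(ER↑_a) ⟹ (ERᶠ_{a,p,α}) for every `(p, α)`** (defect identically `0` on the late window). [this cell] -/
theorem lateKinResponseFloor_of_monotone {a : ℝ} (h : LateKinResponseMonotone a) (p α : ℝ) : LateKinResponseFloor a p α := by
  intro ω₂ lam β γ hω hl hβ hγ T hT
  obtain ⟨N₀, hN₀⟩ := h ω₂ lam β γ hω hl hβ hγ T hT
  refine ⟨0, N₀ + 1, fun N hN t ht => ?_⟩
  obtain ⟨n, rfl⟩ : ∃ n, N = n + 1 := ⟨N - 1, by omega⟩
  obtain ⟨R, hmono, hae⟩ := hN₀ (n + 1) (by omega) t ht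
  have hG := (bathKinCorr_eq_integral_kinKickProfile hω hl hβ hγ hT n t).1
  unfold kinResponseDefect
  rw [thermalCrossDefect_eq_zero_of_ae_monotoneSq hT.le hG hmono hae]
  simp

/-- ★ **(TR↑_a) ⟹ (TRᶠ_{a,p,α}) for every `(p, α)`.** [this cell] -/
theorem lateVarResponseFloor_of_monotone {a : ℝ} (h : LateVarResponseMonotone a) (p α : ℝ) : LateVarResponseFloor a p α := by
  intro ω₂ lam β γ hω hl hβ hγ T hT
  obtain ⟨N₀, hN₀⟩ := h ω₂ lam β γ hω hl hβ hγ T hT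
  refine ⟨0, N₀ + 1, fun N hN t ht => ?_⟩
  obtain ⟨n, rfl⟩ : ∃ n, N = n + 1 := ⟨N - 1, by omega⟩
  obtain ⟨R, hmono, hae⟩ := hN₀ (n + 1) (by omega) t ht
  have hV := (bathVarChannel_eq_integral_varKickProfile hω hl hβ hγ hT n t).1
  unfold varResponseDefect
  rw [thermalCrossDefect_eq_zero_of_ae_monotoneSq hT.le hV hmono hae]
  simp

/-- ★ **(ER∪_a) ⟹ (ER↑_a)**: an a.e.-convex energy response curve is a.e.-monotone in the energy — because the curve is EVEN (§3): symmetrise the convex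
witness (`(R(k) + R(−k))/2` is convex, even, and still a.e. equal to `Ḡ` since `ν_T` is flip-invariant). [this cell] -/
theorem lateKinResponseMonotone_of_convex {a : ℝ} (h : LateKinResponseConvex a) : LateKinResponseMonotone a := by
  intro ω₂ lam β γ hω hl hβ hγ T hT
  obtain ⟨N₀, hN₀⟩ := h ω₂ lam β γ hω hl hβ hγ T hT
  refine ⟨N₀, fun N hN t ht => ?_⟩
  obtain ⟨R, hconv, hae⟩ := hN₀ N hN t ht
  refine ⟨fun k => (R k + R (-k)) / 2, ?_, ?_⟩
  · -- the symmetrisation is convex and even, hence monotone in `k²`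
    have hR' : ConvexOn ℝ Set.univ (fun k => (R k + R (-k)) / 2) := by
      refine ⟨convex_univ, fun x _ y _ a' b' ha hb hab => ?_⟩
      have h1 := hconv.2 (mem_univ x) (mem_univ y) ha hb hab
      have h2 := hconv.2 (mem_univ (-x)) (mem_univ (-y)) ha hb hab
      simp only [smul_eq_mul] at h1 h2 ⊢
      have e : -(a' * x + b' * y) = a' * -x + b' * -y := by ring
      rw [e]
      linarith
    exact monotoneSq_of_convexOn_even hR' (fun k => by simp only [neg_neg]; ring)
  · -- a.e. equality: `Ḡ(k) = Ḡ(−k) = R(−k)` a.e. (flip-invariance of `ν_T`)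
    have heven : ∀ k, kinKickProfile ω₂ lam β γ T N t (-k) = kinKickProfile ω₂ lam β γ T N t k :=
      fun k => (kickProfiles_neg hω hl.le hβ.le hγ.le T N t k).1
    have h2 : (fun k => kinKickProfile ω₂ lam β γ T N t (-k)) =ᵐ[gaussianReal 0 T.toNNReal] (fun k => R (-k)) :=
      hae.comp_tendsto (gaussT_measurePreserving_neg T).quasiMeasurePreserving.tendsto_ae
    filter_upwards [hae, h2] with k hk hk2
    simp only [heven] at hk2
    simp only [← hk, ← hk2]
    ring

/-! ### The assembly beneath the blocker -/

open Summit.AtomisticToContinuum.FouriersLaw.Theses.BondHeatUncertainty (BoundedResponse SubdiffusiveBondHeat)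

/-- ★★ **(S) ∧ (ERᶠ_{a,p,α}) ⟹ 11071** on the echo-tolerant branch `α > 2`, `p ≤ α − 1` (through `LateKernelFloor`, `LateNegMass`, `LateTailFloor`). [this cell] -/
theorem boundedResponse_of_subdiffusiveBondHeat_lateKinResponseFloor {a p α : ℝ} (ha : 0 < a) (hα : 2 < α) (hp : p ≤ α - 1)
    (hS : SubdiffusiveBondHeat) (hR : LateKinResponseFloor a p α) : BoundedResponse :=
  boundedResponse_of_subdiffusiveBondHeat_lateKernelFloor ha hα hp hS (lateKernelFloor_of_lateKinResponseFloor hR)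

/-- (S) ∧ (ERᶠ_{a,p,α}) ⟹ 11071 on the branch `1 < α < 2`, `p ≤ 2α − 3`. [this cell] -/
theorem boundedResponse_of_subdiffusiveBondHeat_lateKinResponseFloor' {a p α : ℝ} (ha : 0 < a) (hα₁ : 1 < α) (hα₂ : α < 2)
    (hp : p ≤ 2 * α - 3) (hS : SubdiffusiveBondHeat) (hR : LateKinResponseFloor a p α) : BoundedResponse :=
  boundedResponse_of_subdiffusiveBondHeat_lateKernelFloor' ha hα₁ hα₂ hp hS (lateKernelFloor_of_lateKinResponseFloor hR)

/-- ★★ **(S) ∧ (ER↑_a) ⟹ 11071**: the atomistic comparison principle past the light cone closes the blocker given (S). [this cell] -/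
theorem boundedResponse_of_subdiffusiveBondHeat_lateKinResponseMonotone {a : ℝ} (ha : 0 < a) (hS : SubdiffusiveBondHeat)
    (hR : LateKinResponseMonotone a) : BoundedResponse :=
  boundedResponse_of_subdiffusiveBondHeat_lateKinResponseFloor ha (by norm_num : (2 : ℝ) < 3) (by norm_num : (2 : ℝ) ≤ 3 - 1) hS
    (lateKinResponseFloor_of_monotone hR 2 3)

/-- ★★ **CHANNEL ASSEMBLY: (S) ∧ (TRᶠ_{a,p,α}) ∧ LateCommonPastFloor a p α ⟹ 11071** (`α > 2`, `p ≤ α − 1`) — the Stein form of the variance channel plus ANY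
supplier of the common-past floor. [this cell] -/
theorem boundedResponse_of_subdiffusiveBondHeat_lateVarResponseFloor {a p α : ℝ} (ha : 0 < a) (hα : 2 < α) (hp : p ≤ α - 1)
    (hS : SubdiffusiveBondHeat) (hV : LateVarResponseFloor a p α) (hP : LateCommonPastFloor a p α) : BoundedResponse :=
  boundedResponse_of_subdiffusiveBondHeat_lateChannelFloors ha hα hp hS hP (lateVarChannelFloor_of_lateVarResponseFloor hV)

/-- **LADDER OF NODE 110** (all arrows PROVED; `a > 0`): kick-convexity ⟹ energy-monotonicity ⟹ response floor (every grade) ⟹ late kernel floor; the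
temperature rungs likewise into the variance channel; the coherent rung into the common-past channel; and the two admissible branches into 11071 given (S).
[this cell] -/
theorem kickLadder {a : ℝ} (ha : 0 < a) :
    (LateKinResponseConvex a → LateKinResponseMonotone a) ∧
    (∀ p α : ℝ, LateKinResponseMonotone a → LateKinResponseFloor a p α) ∧
    (∀ p α : ℝ, LateKinResponseFloor a p α → LateKernelFloor a p α) ∧
    (∀ p α : ℝ, LateVarResponseMonotone a → LateVarResponseFloor a p α) ∧
    (∀ p α : ℝ, LateVarResponseFloor a p α → LateVarChannelFloor a p α) ∧
    (∀ p α : ℝ, LateSqFcastResponseFloor a p α → LateCommonPastFloor a p α) ∧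
    (∀ p α : ℝ, LateSqFcastResponseFloor a p α → LateVarResponseFloor a p α → LateKernelFloor a p α) ∧
    (∀ p α : ℝ, 2 < α → p ≤ α - 1 → SubdiffusiveBondHeat → LateKinResponseFloor a p α → BoundedResponse) ∧
    (SubdiffusiveBondHeat → LateKinResponseMonotone a → BoundedResponse) :=
  ⟨lateKinResponseMonotone_of_convex, fun p α h => lateKinResponseFloor_of_monotone h p α,
   fun _ _ h => lateKernelFloor_of_lateKinResponseFloor h, fun p α h => lateVarResponseFloor_of_monotone h p α,
   fun _ _ h => lateVarChannelFloor_of_lateVarResponseFloor h, fun _ _ h => lateCommonPastFloor_of_lateSqFcastResponseFloor h,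
   fun _ _ hM hV => lateKernelFloor_of_lateChannelFloors (lateCommonPastFloor_of_lateSqFcastResponseFloor hM)
     (lateVarChannelFloor_of_lateVarResponseFloor hV),
   fun _ _ hα hp hS hR => boundedResponse_of_subdiffusiveBondHeat_lateKinResponseFloor ha hα hp hS hR,
   fun hS hR => boundedResponse_of_subdiffusiveBondHeat_lateKinResponseMonotone ha hS hR⟩

end Summit.AtomisticToContinuum.FouriersLaw.Theorems.BoundedResponse.HeatSpreading

end
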